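import Literature.MathematicalPhysics.QuantumFieldTheory.Balaban1983to89.B9Eq346OneSidedLegsModelsL2

/-!
# `Balaban1983to89.B9Eq346OneSidedLegsAtPinsL2` — T. Bałaban, *Propagators for lattice gauge theories in a background field*, Commun. Math. Phys. **99**
# (1985) 389–434 [Balaban1985BackgroundPropagators] Cor 3.6 p. 408 ∕ (3.46) p. 398 ∕ (3.87)–(3.89) p. 409: ★★★ **THE TWO LETTER-FREE `L²` LEGS
# `∇_{U,ν}G′_□M_{h_□}∇*_{U,μ}` AND `G′_□M_{h_□}∇*_{U,μ}` — the hypotheses `hMix`, `hOne` of `B9RWSums346MixedFactorFromLegs.factorsL2Mixed37Dir_of_letterL2_legs` —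
# PROVED AT THE N06 CERTIFICATE's COORDINATE MODELS from node00-def-Y's genuine letters** (`Gsq = gsqcoS`, `h = hWalkY`, `Dd ν = η⁻¹ • coordOpK (cdSL ν)`,
# `Dsd μ = η⁻¹ • coordOpK (cdsSL μ)`, `blk = blkSK (sIK bI)`; the analytic input is `B9Eq346OneSidedLegsAtCubesTorusL2`, the models and their torus bounds are the prequel `B9Eq346OneSidedLegsModelsL2`)

statement-level skeleton of published theorems with citation tags; proofs where landed; nothing here is a claim about the Yang–Mills mass gap

THE PRINT.  (3.46) p. 398: *«‖h∇_UG′(U)∇\*_Uλ‖ ≤ B₀·1·e^{−δ₀d(y,y′)}‖h‖‖λ‖»*, *«‖hG′(U)∇\*_Uλ‖ ≤ B₀·Lʲη·…»*; Cor 3.6 p. 408 («constants independent of □»); (3.88)–(3.89)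
p. 409; p. 393 (`X·Y = tr XY`, the coordinates); [4] (2.46) p. 231, (2.51)–(2.54) pp. 232–233, Lemma 2.1 (2.61) p. 234.

WHY THIS FILE (cell `pub-ymgap`, Track A node N06 [B9], rows 18; width seat `pub-ymgap-dag-n06-w7`, g1, 2026-08-28).  With `B9RWSums346MixedFactorFromLegs` ∕
`B9RWSums346LetterL2FromMajorants` the certificate's displayed conjunct `FactorsL2Mixed37Dir (𝔬 x) (𝔡 x) (𝔩 x) 1 (H x) pM.θM p.δ₀ U` follows from displayed data, two
letter transposes and the two legs `hMix`, `hOne`; THIS FILE inhabits the two legs at the certificate's pins (the `blockBd_mixedLeg_memberY` pattern of this seat's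
`B9Eq346MixedLegAtPinsL2`, now with the cut-off on ONE side and, for the first-order leg, print's scale factor `Lʲη` read as `(geo9Y x).len`):
* §3 AT THE PINS — ★★★ `blockBd_mixedLegR_memberY` (`∃ M a B δ > 0`, … ⊢ `BlockBd blk blk (Dd ν ∘ ((Gsq ic·M_{h ic}) ∘ Dsd μ)) (B·e^{−δd})` = FILE 1's `hMix` body) and
  ★★★ `blockBd_oneLeg_memberY` (… ⊢ `BlockBd blk blk ((Gsq ic·M_{h ic}) ∘ Dsd μ) (B·len a·e^{−δd})` = `hOne`), member level, c-generic `Reg335 c₀ α₀ U`.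
HONEST SCOPE.  Dictionary + re-blocking over landed modules; the analytic input is dag-n06-w1's cube estimates (via the prequel); nothing of [B9] asserted beyond
kernel-checked parents; COUNT-NEUTRAL; N06 NOT discharged; K1⁹ NOT closed; nothing continuum ∕ OS ∕ mass gap ∕ Clay.  NEW file; nothing landed is modified.
-/

noncomputable section

namespace Literature.MathematicalPhysics.QuantumFieldTheory.Balaban1983to89.B9Eq346OneSidedLegsAtPinsL2

open Literature.MathematicalPhysics.QuantumFieldTheory.Balaban1983to89
open Node00 B6KLevelCensusIndexV1 B6Geom246MultiLevelBox B6MultiLevelTorusOperator B6GlobalChartV1 B9BackgroundsKLevelV1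
  B9Eq39Adjoint B9Thm311ReadingCoords B6Geom246MultiLevelTorus B9Eq346MixedLegAtCubesTorusL2 B9Eq346GradGpDivCoordsL2 B9Eq346GradGpDivAtPinsL2
  B9Eq346OneSidedLegsAtCubesTorusL2 B9Eq346MixedLegAtPinsL2 B9Eq346OneSidedLegsModelsL2
open Literature.MathematicalPhysics.QuantumFieldTheory.Balaban1983to89.B6Ineq2142KLevelV1 (lvl β)
open Literature.MathematicalPhysics.QuantumFieldTheory.Balaban1983to89.B9Thm314GpFlatMultiLevelTorus (consts_260_261)
open Literature.MathematicalPhysics.QuantumFieldTheory.Balaban1983to89.B6Lemma21Repaired (Ineq261With)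
open Literature.MathematicalPhysics.QuantumFieldTheory.Balaban1983to89.B9GeoNormsKLevelV1 (geo9K geo9K_len_kGeo)
open Literature.MathematicalPhysics.QuantumFieldTheory.Balaban1983to89.B9GeoLemma21KLevelV1 (one_le_Mh)
open Literature.MathematicalPhysics.QuantumFieldTheory.Balaban1983to89.B9Ineq349SiteComposite (cdSL cdsSL cdSL_apply cdsSL_apply etaS_pos)
open Literature.MathematicalPhysics.QuantumFieldTheory.Balaban1983to89.B9Thm39ReadingCoords (cR39 cR39_nonneg)
open Literature.MathematicalPhysics.QuantumFieldTheory.Balaban1983to89.B9CoReadingCoords (assembleK coordOpK coordOpK_apply coordOpK_comp)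
open Literature.MathematicalPhysics.QuantumFieldTheory.Balaban1983to89.B9CoReadingCoordsH (coordOpKH)
open Literature.MathematicalPhysics.QuantumFieldTheory.Balaban1983to89.B9CoReadingCoordsS (XSK blkSK sIK GcoS blkV1_site)
open Literature.MathematicalPhysics.QuantumFieldTheory.Balaban1983to89.B9CoReadingCoordsTranspose (TrIdx trBasis)
open Literature.MathematicalPhysics.QuantumFieldTheory.Balaban1983to89.B9Thm34Ext (toB6)
open Literature.MathematicalPhysics.QuantumFieldTheory.Balaban1983to89.B9SectDL2Decay (bsq bl2 BlockBd bsq_nonneg bl2_nonneg)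
open Literature.MathematicalPhysics.QuantumFieldTheory.Balaban1983to89.B9PinMembersKLevelV1 (MemberY geo9Y bg9Y reg335Y_iff)
open Literature.MathematicalPhysics.QuantumFieldTheory.Balaban1983to89.B9Thm37Sum (mulOp)
open Literature.MathematicalPhysics.QuantumFieldTheory.Balaban1983to89.B9Thm37Whole (Ops)
open Literature.MathematicalPhysics.QuantumFieldTheory.Balaban1983to89.B9RWSums346SecondDiffGp (DirOps37)
open Literature.MathematicalPhysics.QuantumFieldTheory.Balaban1983to89.B9Thm37CubeCoverCommutators (cutMulY cutMulY_apply hTY)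
open Literature.MathematicalPhysics.QuantumFieldTheory.Balaban1983to89.B6Partition118KLevelFineSizes (C1F)
open Literature.MathematicalPhysics.QuantumFieldTheory.Balaban1983to89.B6Cover236MultiLevelBlocks (cubes)
open Literature.MathematicalPhysics.QuantumFieldTheory.Balaban1983to89.B9WalkLettersCoordsS (cubeDomY SblkY hWalkY gsqcoS)
open Literature.MathematicalPhysics.QuantumFieldTheory.Balaban1983to89.Node00.OpsYLocalInverse (GsqY)
open Literature.MathematicalPhysics.QuantumFieldTheory.Balaban1983to89.Node00.OpsYSectDCoords (repr_assembleK coordOpKH_eq_coordOpK)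
open Literature.MathematicalPhysics.QuantumFieldTheory.Balaban1983to89.B9Thm311DeltaPrimePos (trIP_self_nonneg)
open scoped Matrix Matrix.Norms.L2Operator

variable {d ℓ : ℕ} {hd : 1 ≤ d + 1} {hL : Odd (ℓ + 1) ∧ 1 < ℓ + 1} {b₀ b₁ : ℝ} {Mstar : ℕ}
variable (x : MemberY d ℓ hd hL b₀ b₁ Mstar) {N : ℕ} {G : Subgroup (Matrix (Fin N) (Fin N) ℂ)ˣ}

/-! ## The two legs at the certificate's pins -/

section AtPins

/-- the common member-level regime facts: the certificate's prefix `M_M ≤ M`, `c₀·M·α₀ ≤ 1∕(16(d+1))`, `U ∈ Reg335 c₀ α₀` gives dag-n06-w1's class hypotheses, and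
[4] Lemma 2.1's row sum (2.61) holds at the member for `M ≥ N₁ + 1`. [cite: Balaban1985BackgroundPropagators, (3.35) p.396, Cor 3.6 p.408; Balaban1984PropagatorsII, Lemma 2.1 (2.61) p.234] -/
private theorem regime_facts {c₀ : ℝ} (hc₀ : 0 < c₀) {N₁ : ℕ} {cr δ₁ : ℝ}
    (hcon : ∀ (k Mh R : ℕ) (P : Fin (d + 1) → ℕ), 1 ≤ Mh → (∀ μ, 1 ≤ P μ) → N₁ + 1 ≤ R * ((ℓ + 1) * Mh) →
      ((ℓ : ℝ) + 1) ^ 2 ≤ Real.exp (1 / 4 * δ₁ * ((R : ℝ) * (((ℓ : ℝ) + 1) * Mh) - 1)) ∧ ∀ D : TDomains d ℓ Mh k P R, Ineq261With cr (geomT D) δ₁ (1 / 4))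
    (hM : (N₁ : ℝ) + 1 ≤ (geo9Y x).M) {α₀ : ℝ} (hα₀ : 0 < α₀) (ha : c₀ * (geo9Y x).M * α₀ ≤ 1 / (16 * ((d : ℝ) + 1)))
    {U : (bg9Y (Matrix (Fin N) (Fin N) ℂ) G x).Cfg} (hU : (bg9Y (Matrix (Fin N) (Fin N) ℂ) G x).Reg335 c₀ α₀ U) :
    0 ≤ c₀ * (geo9Y x).M * α₀ ∧ c₀ * (geo9Y x).M * α₀ * ((d : ℝ) + 1) ≤ 1 / 16 ∧ (bg9K (Matrix (Fin N) (Fin N) ℂ) G x.toKIdx).Reg335 c₀ α₀ U ∧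
      Ineq261With cr (geomT x.toKIdx.D) δ₁ (1 / 4) := by
  have hM0 : 0 ≤ (geo9Y x).M := le_trans (by positivity) hM
  refine ⟨by positivity, ?_, ((reg335Y_iff x c₀ α₀ U).1 hU).1, ?_⟩
  · calc c₀ * (geo9Y x).M * α₀ * ((d : ℝ) + 1) ≤ 1 / (16 * ((d : ℝ) + 1)) * ((d : ℝ) + 1) := mul_le_mul_of_nonneg_right ha (by positivity)
      _ = 1 / 16 := by field_simp
  · have hLcast : (((ℓ + 1 : ℕ) : ℝ)) = (ℓ : ℝ) + 1 := by push_cast; ring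
    have hMdef : (geo9Y x).M = (((ℓ + 1 : ℕ) : ℝ)) * (x.toKIdx.Mh : ℝ) := rfl
    have hN : (N₁ : ℝ) + 1 ≤ ((ℓ : ℝ) + 1) * x.toKIdx.Mh := by rw [← hLcast, ← hMdef]; exact hM
    have hR1 : 1 ≤ x.toKIdx.R := le_trans (by omega) (toKT x.toKIdx).hR
    have hRN : N₁ + 1 ≤ x.toKIdx.R * ((ℓ + 1) * x.toKIdx.Mh) := by
      have h2 : N₁ + 1 ≤ (ℓ + 1) * x.toKIdx.Mh := by exact_mod_cast hN
      calc N₁ + 1 ≤ 1 * ((ℓ + 1) * x.toKIdx.Mh) := by rw [one_mul]; exact h2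
        _ ≤ x.toKIdx.R * ((ℓ + 1) * x.toKIdx.Mh) := Nat.mul_le_mul_right _ hR1
    exact (hcon x.toKIdx.k x.toKIdx.Mh x.toKIdx.R x.toKIdx.P' (one_le_Mh x.toKIdx) (toKT x.toKIdx).hP hRN).2 x.toKIdx.D

/-- ★★★ **THE UNCUT MIXED LEG `∇_{U,ν}G′_□M_{h_□}∇\*_{U,μ}` AT THE CERTIFICATE's PINS** (the hypothesis `hMix` of `factorsL2Mixed37Dir_of_letterL2_legs`, letter-generic): there
are `M, a, B, δ > 0` (on `d, ℓ, N, c₀`) such that for `G ≤ U(N)`, `N ≥ 1`, every member `x` with `M ≤ M_x`, every `α₀ > 0` with `c₀·M_x·α₀ ≤ a`, every configuration `U` of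
the member in the (3.35) class, every level-∕1-faithful `bI`, every `R₀ H₀`, and ALL walk-letter records `𝔬 𝔡` (any `ι`, one index `ic` pinned to the cube `c`) with
`𝔬.blk = blkSK (sIK bI)`, `𝔬.h ic = hWalkY x c`, `𝔬.Gsq U ic = gsqcoS … c U`, `𝔡.Dd U ν = η⁻¹ • coordOpK (cdSL U ν)`, `𝔡.Dsd U μ = η⁻¹ • coordOpK (cdsSL U μ)`:
`BlockBd (toB6 (geo9Y x) R₀ H₀) 𝔬.blk 𝔬.blk (𝔡.Dd U ν ∘ₗ ((𝔬.Gsq U ic * mulOp (𝔬.h ic)) ∘ₗ 𝔡.Dsd U μ)) (B·e^{−δ·d(a,a′)})`.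
[cite: Balaban1985BackgroundPropagators, Cor 3.6 p.408, Thm 3.1 (3.46) p.398, (3.87)–(3.89) p.409, (3.35) p.396; Balaban1984PropagatorsII, (2.46) p.231, (2.51)–(2.54) pp.232–233, Lemma 2.1 (2.61) p.234; Agmon1982, Ch.1, Thm 1.5] -/
theorem blockBd_mixedLegR_memberY (d ℓ : ℕ) (hd : 1 ≤ d + 1) (hL : Odd (ℓ + 1) ∧ 1 < ℓ + 1) (b₀ b₁ : ℝ) (Mstar N : ℕ) [NeZero N] {c₀ : ℝ} (hc₀ : 0 < c₀) :
    ∃ MM aM BM δM : ℝ, 0 < MM ∧ 0 < aM ∧ 0 < BM ∧ 0 < δM ∧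
      ∀ {G : Subgroup (Matrix (Fin N) (Fin N) ℂ)ˣ} (_ : G ≤ B7Prop2Explicit.unitaryUnits (Matrix (Fin N) (Fin N) ℂ))
        (x : MemberY d ℓ hd hL b₀ b₁ Mstar), MM ≤ (geo9Y x).M → ∀ α₀ : ℝ, 0 < α₀ → c₀ * (geo9Y x).M * α₀ ≤ aM →
      ∀ (U : (bg9Y (Matrix (Fin N) (Fin N) ℂ) G x).Cfg), (bg9Y (Matrix (Fin N) (Fin N) ℂ) G x).Reg335 c₀ α₀ U →
      ∀ {bI : FBondY x.toKIdx → IBondY x.toKIdx} (_ : ∀ f, lvl x.hN x.D x.hk (bI f) = (blkV1 x.hN x.D f).1.1)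
        (_ : ∀ f, (geomT x.D).dist (β x.hN x.D x.hk (bI f)) (blkV1 x.hN x.D f) ≤ 1) (R₀ : ℝ) (H₀ : Prop) [Fintype (geo9Y x).Site]
        {Y ι : Type} (𝔬 : Ops (geo9Y x) (bg9Y (Matrix (Fin N) (Fin N) ℂ) G x) (XSK (TrIdx N) x.toKIdx) Y ι) (𝔡 : DirOps37 𝔬 (Fin (d + 1)))
        (c : ↥(cubes x.toKIdx.D.toDomains)) (ic : ι) (ν μ : Fin (d + 1))
        (_ : 𝔬.blk = blkSK x.toKIdx (sIK x.toKIdx bI)) (_ : 𝔬.h ic = hWalkY x c)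
        (_ : 𝔬.Gsq U ic = gsqcoS x (trBasis N) (bg9Y (Matrix (Fin N) (Fin N) ℂ) G x) (fun U => U) (parSymY x.toKIdx) c U)
        (_ : 𝔡.Dd U ν = (etaS x.toKIdx)⁻¹ • coordOpK (trBasis N) (fun _ : Fin (d + 1) => (cdSL x.toKIdx U ν).restrictScalars ℝ))
        (_ : 𝔡.Dsd U μ = (etaS x.toKIdx)⁻¹ • coordOpK (trBasis N) (fun _ : Fin (d + 1) => (cdsSL x.toKIdx U μ).restrictScalars ℝ)),
        BlockBd (g := toB6 (geo9Y x) R₀ H₀) 𝔬.blk 𝔬.blk (𝔡.Dd U ν ∘ₗ ((𝔬.Gsq U ic * mulOp (𝔬.h ic)) ∘ₗ 𝔡.Dsd U μ))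
          (fun a a' => BM * Real.exp (-(δM * (geo9Y x).dist a a'))) := by
  set δ₀ : ℝ := 1 / (4 * ((d : ℝ) + 2)) with hδ₀
  set δ₁ : ℝ := δ₀ / (2 * ((ℓ + 1 : ℕ) : ℝ)) with hδ₁
  have hδ₀pos : 0 < δ₀ := by rw [hδ₀]; positivity
  have hδ₁pos : 0 < δ₁ := by rw [hδ₁]; positivity
  obtain ⟨N₁, cr, -, hcr0, hcon⟩ := consts_260_261 d ℓ hδ₁pos
  set C₁ : ℝ := Real.sqrt (20 + 320 * ((5 * C1F d ℓ / 8) ^ 2 * (((ℓ + 1 : ℕ) : ℝ)) ^ 4)) * Real.exp ((1 / (4 * ((d : ℝ) + 2))) * (1 + 1 / (2 * ((ℓ + 1 : ℕ) : ℝ)))) with hC₁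
  have hC₁0 : 0 ≤ C₁ := by positivity
  set BM : ℝ := max (cR39 (trBasis N) * (C₁ * cr * Real.exp (3 / 2 * δ₁) * Real.sqrt (Real.exp (1 / 4 * δ₁) * cr))) 1 with hBM
  refine ⟨(N₁ : ℝ) + 1, 1 / (16 * ((d : ℝ) + 1)), BM, 3 / 4 * δ₁, by positivity, by positivity, lt_of_lt_of_le one_pos (le_max_right _ _), by positivity, ?_⟩
  intro G hG x hM α₀ hα₀ ha U hU bI hlev hβ1 R₀ H₀ _ Y ι 𝔬 𝔡 c ic ν μ hblk hh hGsq hDd hDsd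
  haveI : Nonempty (Fin N) := ⟨⟨0, Nat.pos_of_ne_zero (NeZero.ne N)⟩⟩
  obtain ⟨hC0, hC1, hreg, h261D⟩ := regime_facts x hc₀ hcon hM hα₀ ha hU
  -- the torus bound of the model, re-blocked on `blkSK (sIK bI) = bI ∘ π`, scaled by `c_R`
  have hT := blockBd_torus_coordOpKH_mixedLegR x hG (U := U) hC0 hC1 hreg c ν μ
  have hπ : (fun p : XSK (TrIdx N) x.toKIdx => blkOf x.toKIdx.D.toDomains p.1)
      = (fun p : XSK (TrIdx N) x.toKIdx => blkV1 x.hN x.D ((fun q : XSK (TrIdx N) x.toKIdx => (⟨(boxEquiv x.toKIdx.hN).symm q.1, 0⟩ : FBondY x.toKIdx)) p)) := by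
    funext p; exact (blkV1_site x.toKIdx p.1).symm
  rw [hπ] at hT
  letI : Fintype (geo9K x.toKIdx).Site := (inferInstance : Fintype (geo9Y x).Site)
  have hre := blockBd_pull_bI_of_blockBd_torus x.toKIdx (X := XSK (TrIdx N) x.toKIdx)
    (fun q : XSK (TrIdx N) x.toKIdx => (⟨(boxEquiv x.toKIdx.hN).symm q.1, 0⟩ : FBondY x.toKIdx)) hlev hβ1 hC₁0 hδ₁pos.le hT h261D R₀ H₀
  have hsm := blockBd_smul_of_nonneg' hre (cR39_nonneg (trBasis N))
  rw [coordOpKH_eq_coordOpK] at hsm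
  have hblk' : (fun q : XSK (TrIdx N) x.toKIdx => bI (⟨(boxEquiv x.toKIdx.hN).symm q.1, 0⟩ : FBondY x.toKIdx)) = 𝔬.blk := by rw [hblk]; rfl
  rw [hblk'] at hsm
  -- the pinned operator is `c_R •` the model
  rw [hDd, hDsd, hGsq, hh, mixedLegR_model_eq x (bg9Y (Matrix (Fin N) (Fin N) ℂ) G x) (fun U => U) U c ν μ]
  refine hsm.mono fun a a' => ?_
  have hle : cR39 (trBasis N) * (C₁ * cr * Real.exp (3 / 2 * δ₁) * Real.sqrt (Real.exp (1 / 4 * δ₁) * cr)) ≤ BM := le_max_left _ _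
  have hexp0 : 0 ≤ Real.exp (-(3 / 4 * δ₁ * (geo9Y x).dist a a')) := (Real.exp_pos _).le
  calc cR39 (trBasis N) * (C₁ * cr * Real.exp (3 / 2 * δ₁) * Real.sqrt (Real.exp (1 / 4 * δ₁) * cr) * Real.exp (-(3 / 4 * δ₁ * (geo9K x.toKIdx).dist a a')))
      = (cR39 (trBasis N) * (C₁ * cr * Real.exp (3 / 2 * δ₁) * Real.sqrt (Real.exp (1 / 4 * δ₁) * cr))) * Real.exp (-(3 / 4 * δ₁ * (geo9Y x).dist a a')) := by
        rw [show (geo9K x.toKIdx).dist a a' = (geo9Y x).dist a a' from rfl]; ring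
    _ ≤ BM * Real.exp (-(3 / 4 * δ₁ * (geo9Y x).dist a a')) := mul_le_mul_of_nonneg_right hle hexp0

/-- ★★★ **THE FIRST-ORDER LEG `G′_□M_{h_□}∇\*_{U,μ}` AT THE CERTIFICATE's PINS** (the hypothesis `hOne` of `factorsL2Mixed37Dir_of_letterL2_legs`, letter-generic), in the same
regime and at the same pins: `BlockBd (toB6 (geo9Y x) R₀ H₀) 𝔬.blk 𝔬.blk ((𝔬.Gsq U ic * mulOp (𝔬.h ic)) ∘ₗ 𝔡.Dsd U μ) (B·(geo9Y x).len a·e^{−δ·d(a,a′)})` — print's one power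
of `Lʲη` at the output block. [cite: Balaban1985BackgroundPropagators, Cor 3.6 p.408, Thm 3.1 (3.46) p.398, (3.41) p.397, (3.87)–(3.89) p.409, (3.35) p.396; Balaban1984PropagatorsII, (2.46) p.231, (2.51)–(2.54) pp.232–233, Lemma 2.1 (2.61) p.234; Agmon1982, Ch.1, Thm 1.5] -/
theorem blockBd_oneLeg_memberY (d ℓ : ℕ) (hd : 1 ≤ d + 1) (hL : Odd (ℓ + 1) ∧ 1 < ℓ + 1) (b₀ b₁ : ℝ) (Mstar N : ℕ) [NeZero N] {c₀ : ℝ} (hc₀ : 0 < c₀) :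
    ∃ M1 a1 B1 δ1 : ℝ, 0 < M1 ∧ 0 < a1 ∧ 0 < B1 ∧ 0 < δ1 ∧
      ∀ {G : Subgroup (Matrix (Fin N) (Fin N) ℂ)ˣ} (_ : G ≤ B7Prop2Explicit.unitaryUnits (Matrix (Fin N) (Fin N) ℂ))
        (x : MemberY d ℓ hd hL b₀ b₁ Mstar), M1 ≤ (geo9Y x).M → ∀ α₀ : ℝ, 0 < α₀ → c₀ * (geo9Y x).M * α₀ ≤ a1 →
      ∀ (U : (bg9Y (Matrix (Fin N) (Fin N) ℂ) G x).Cfg), (bg9Y (Matrix (Fin N) (Fin N) ℂ) G x).Reg335 c₀ α₀ U →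
      ∀ {bI : FBondY x.toKIdx → IBondY x.toKIdx} (_ : ∀ f, lvl x.hN x.D x.hk (bI f) = (blkV1 x.hN x.D f).1.1)
        (_ : ∀ f, (geomT x.D).dist (β x.hN x.D x.hk (bI f)) (blkV1 x.hN x.D f) ≤ 1) (R₀ : ℝ) (H₀ : Prop) [Fintype (geo9Y x).Site]
        {Y ι : Type} (𝔬 : Ops (geo9Y x) (bg9Y (Matrix (Fin N) (Fin N) ℂ) G x) (XSK (TrIdx N) x.toKIdx) Y ι) (𝔡 : DirOps37 𝔬 (Fin (d + 1)))
        (c : ↥(cubes x.toKIdx.D.toDomains)) (ic : ι) (μ : Fin (d + 1))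
        (_ : 𝔬.blk = blkSK x.toKIdx (sIK x.toKIdx bI)) (_ : 𝔬.h ic = hWalkY x c)
        (_ : 𝔬.Gsq U ic = gsqcoS x (trBasis N) (bg9Y (Matrix (Fin N) (Fin N) ℂ) G x) (fun U => U) (parSymY x.toKIdx) c U)
        (_ : 𝔡.Dsd U μ = (etaS x.toKIdx)⁻¹ • coordOpK (trBasis N) (fun _ : Fin (d + 1) => (cdsSL x.toKIdx U μ).restrictScalars ℝ)),
        BlockBd (g := toB6 (geo9Y x) R₀ H₀) 𝔬.blk 𝔬.blk ((𝔬.Gsq U ic * mulOp (𝔬.h ic)) ∘ₗ 𝔡.Dsd U μ)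
          (fun a a' => B1 * (geo9Y x).len a ^ (1 : ℝ) * Real.exp (-(δ1 * (geo9Y x).dist a a'))) := by
  set δ₀ : ℝ := 1 / (4 * ((d : ℝ) + 2)) with hδ₀
  set δ₁ : ℝ := δ₀ / (2 * ((ℓ + 1 : ℕ) : ℝ)) with hδ₁
  have hδ₀pos : 0 < δ₀ := by rw [hδ₀]; positivity
  have hδ₁pos : 0 < δ₁ := by rw [hδ₁]; positivity
  obtain ⟨N₁, cr, -, hcr0, hcon⟩ := consts_260_261 d ℓ hδ₁pos
  set C₁ : ℝ := Real.sqrt (32 + 512 * ((5 * C1F d ℓ / 8) ^ 2 * (((ℓ + 1 : ℕ) : ℝ)) ^ 4)) * Real.exp ((1 / (4 * ((d : ℝ) + 2))) * (1 + 1 / (2 * ((ℓ + 1 : ℕ) : ℝ)))) with hC₁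
  have hC₁0 : 0 ≤ C₁ := by positivity
  set B1 : ℝ := max (cR39 (trBasis N) * (C₁ * cr * Real.exp (3 / 2 * δ₁) * Real.sqrt (Real.exp (1 / 4 * δ₁) * cr))) 1 with hB1
  refine ⟨(N₁ : ℝ) + 1, 1 / (16 * ((d : ℝ) + 1)), B1, 3 / 4 * δ₁, by positivity, by positivity, lt_of_lt_of_le one_pos (le_max_right _ _), by positivity, ?_⟩
  intro G hG x hM α₀ hα₀ ha U hU bI hlev hβ1 R₀ H₀ _ Y ι 𝔬 𝔡 c ic μ hblk hh hGsq hDsd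
  haveI : Nonempty (Fin N) := ⟨⟨0, Nat.pos_of_ne_zero (NeZero.ne N)⟩⟩
  obtain ⟨hC0, hC1, hreg, h261D⟩ := regime_facts x hc₀ hcon hM hα₀ ha hU
  -- the block scale `w = L^{j(z)}` as a real site function
  set w : SiteY x.toKIdx → ℝ := fun z => (((ℓ + 1) ^ (blkOf x.toKIdx.D.toDomains z).1.1 : ℕ) : ℝ) with hwdef
  have hw : ∀ z, w z = (((ℓ + 1) ^ (blkOf x.toKIdx.D.toDomains z).1.1 : ℕ) : ℝ) := fun z => rfl
  have hw0 : ∀ z, w z ≠ 0 := fun z => by rw [hw z]; positivity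
  -- the torus bound of the SCALED model, re-blocked on `blkSK (sIK bI) = bI ∘ π`, scaled by `η·c_R`
  have hT := blockBd_torus_coordOpKH_oneLegScaled x hG (U := U) hC0 hC1 hreg c μ w hw
  have hπ : (fun p : XSK (TrIdx N) x.toKIdx => blkOf x.toKIdx.D.toDomains p.1)
      = (fun p : XSK (TrIdx N) x.toKIdx => blkV1 x.hN x.D ((fun q : XSK (TrIdx N) x.toKIdx => (⟨(boxEquiv x.toKIdx.hN).symm q.1, 0⟩ : FBondY x.toKIdx)) p)) := by
    funext p; exact (blkV1_site x.toKIdx p.1).symm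
  rw [hπ] at hT
  letI : Fintype (geo9K x.toKIdx).Site := (inferInstance : Fintype (geo9Y x).Site)
  have hre := blockBd_pull_bI_of_blockBd_torus x.toKIdx (X := XSK (TrIdx N) x.toKIdx)
    (fun q : XSK (TrIdx N) x.toKIdx => (⟨(boxEquiv x.toKIdx.hN).symm q.1, 0⟩ : FBondY x.toKIdx)) hlev hβ1 hC₁0 hδ₁pos.le hT h261D R₀ H₀
  have hη0 : 0 ≤ etaS x.toKIdx * cR39 (trBasis N) := mul_nonneg (etaS_pos x.toKIdx).le (cR39_nonneg (trBasis N))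
  have hsm := blockBd_smul_of_nonneg' hre hη0
  rw [coordOpKH_eq_coordOpK] at hsm
  have hblk' : (fun q : XSK (TrIdx N) x.toKIdx => bI (⟨(boxEquiv x.toKIdx.hN).symm q.1, 0⟩ : FBondY x.toKIdx)) = 𝔬.blk := by rw [hblk]; rfl
  rw [hblk'] at hsm
  -- the block scale is constant on the pinned blocks: `L^{j(z)} = L^{lvl (𝔬.blk p)}`
  have hscl : ∀ p : XSK (TrIdx N) x.toKIdx, w p.1 = (((ℓ + 1) ^ (lvl x.hN x.D x.hk (𝔬.blk p)) : ℕ) : ℝ) := by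
    intro p
    rw [hw, hblk]
    show (((ℓ + 1) ^ (blkOf x.toKIdx.D.toDomains p.1).1.1 : ℕ) : ℝ) = (((ℓ + 1) ^ (lvl x.hN x.D x.hk (bI ⟨(boxEquiv x.toKIdx.hN).symm p.1, 0⟩)) : ℕ) : ℝ)
    rw [hlev, blkV1_site]
  -- the pinned operator is `(η·c_R) •` (multiplier ∘ scaled model)
  rw [hDsd, hGsq, hh, oneLeg_model_eq x (bg9Y (Matrix (Fin N) (Fin N) ℂ) G x) (fun U => U) U c μ, coordOpK_oneLeg_eq_mulOp_scaled x U c μ w hw0]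
  intro a' ω hω a
  dsimp only
  have hle : cR39 (trBasis N) * (C₁ * cr * Real.exp (3 / 2 * δ₁) * Real.sqrt (Real.exp (1 / 4 * δ₁) * cr)) ≤ B1 := le_max_left _ _
  have hb0 := bl2_nonneg (g := toB6 (geo9Y x) R₀ H₀) 𝔬.blk a' ω
  -- the multiplier pulls the factor `L^{lvl a}` out of the block size
  have hmul : ((etaS x.toKIdx * cR39 (trBasis N)) • (mulOp (fun p : XSK (TrIdx N) x.toKIdx => w p.1) ∘ₗ
        coordOpK (trBasis N) (fun _ : Fin (d + 1) => (cutMulY (fun z => (w z)⁻¹) ∘ₗ GsqY x.toKIdx (parSymY x.toKIdx) (cubeDomY x c) U ∘ₗ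
          cutMulY (hTY x.toKIdx c) ∘ₗ cdsSL x.toKIdx U μ).restrictScalars ℝ))) ω
      = (fun p => (((ℓ + 1) ^ (lvl x.hN x.D x.hk (𝔬.blk p)) : ℕ) : ℝ) *
          (((etaS x.toKIdx * cR39 (trBasis N)) • coordOpK (trBasis N) (fun _ : Fin (d + 1) => (cutMulY (fun z => (w z)⁻¹) ∘ₗ
            GsqY x.toKIdx (parSymY x.toKIdx) (cubeDomY x c) U ∘ₗ cutMulY (hTY x.toKIdx c) ∘ₗ cdsSL x.toKIdx U μ).restrictScalars ℝ)) ω p)) := by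
    funext p
    rw [LinearMap.smul_apply, LinearMap.comp_apply, Pi.smul_apply, LinearMap.smul_apply, Pi.smul_apply, smul_eq_mul, smul_eq_mul, ← hscl p]
    show etaS x.toKIdx * cR39 (trBasis N) * (w p.1 * _) = _
    ring
  rw [hmul, bl2_mulOp_blockConst (G' := toB6 (geo9Y x) R₀ H₀) 𝔬.blk (fun a => (((ℓ + 1) ^ (lvl x.hN x.D x.hk a) : ℕ) : ℝ)) a]
  have hpow0 : 0 ≤ (((ℓ + 1) ^ (lvl x.hN x.D x.hk a) : ℕ) : ℝ) := by positivity
  rw [abs_of_nonneg hpow0]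
  have hlen : (geo9Y x).len a ^ (1 : ℝ) = (((ℓ + 1) ^ (lvl x.hN x.D x.hk a) : ℕ) : ℝ) * etaS x.toKIdx := by rw [Real.rpow_one]; exact len_eq_pow_mul_etaS x a
  have hstep := hsm a' ω hω a
  dsimp only at hstep
  have hexp0 : 0 ≤ Real.exp (-(3 / 4 * δ₁ * (geo9Y x).dist a a')) := (Real.exp_pos _).le
  have hdist : (geo9K x.toKIdx).dist a a' = (geo9Y x).dist a a' := rfl
  rw [hdist] at hstep
  calc (((ℓ + 1) ^ (lvl x.hN x.D x.hk a) : ℕ) : ℝ) * bl2 (g := toB6 (geo9Y x) R₀ H₀) 𝔬.blk a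
          (((etaS x.toKIdx * cR39 (trBasis N)) • coordOpK (trBasis N) (fun _ : Fin (d + 1) => (cutMulY (fun z => (w z)⁻¹) ∘ₗ
            GsqY x.toKIdx (parSymY x.toKIdx) (cubeDomY x c) U ∘ₗ cutMulY (hTY x.toKIdx c) ∘ₗ cdsSL x.toKIdx U μ).restrictScalars ℝ)) ω)
      ≤ (((ℓ + 1) ^ (lvl x.hN x.D x.hk a) : ℕ) : ℝ) * (etaS x.toKIdx * cR39 (trBasis N) *
          (C₁ * cr * Real.exp (3 / 2 * δ₁) * Real.sqrt (Real.exp (1 / 4 * δ₁) * cr) * Real.exp (-(3 / 4 * δ₁ * (geo9Y x).dist a a'))) *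
          bl2 (g := toB6 (geo9Y x) R₀ H₀) 𝔬.blk a' ω) := mul_le_mul_of_nonneg_left hstep hpow0
    _ = (cR39 (trBasis N) * (C₁ * cr * Real.exp (3 / 2 * δ₁) * Real.sqrt (Real.exp (1 / 4 * δ₁) * cr))) *
          ((((ℓ + 1) ^ (lvl x.hN x.D x.hk a) : ℕ) : ℝ) * etaS x.toKIdx) * Real.exp (-(3 / 4 * δ₁ * (geo9Y x).dist a a')) *
          bl2 (g := toB6 (geo9Y x) R₀ H₀) 𝔬.blk a' ω := by ring
    _ ≤ B1 * ((((ℓ + 1) ^ (lvl x.hN x.D x.hk a) : ℕ) : ℝ) * etaS x.toKIdx) * Real.exp (-(3 / 4 * δ₁ * (geo9Y x).dist a a')) *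
          bl2 (g := toB6 (geo9Y x) R₀ H₀) 𝔬.blk a' ω :=
        mul_le_mul_of_nonneg_right (mul_le_mul_of_nonneg_right (mul_le_mul_of_nonneg_right hle (mul_nonneg hpow0 (etaS_pos x.toKIdx).le)) hexp0) hb0
    _ = B1 * (geo9Y x).len a ^ (1 : ℝ) * Real.exp (-(3 / 4 * δ₁ * (geo9Y x).dist a a')) * bl2 (g := toB6 (geo9Y x) R₀ H₀) 𝔬.blk a' ω := by rw [hlen]

end AtPins

end Literature.MathematicalPhysics.QuantumFieldTheory.Balaban1983to89.B9Eq346OneSidedLegsAtPinsL2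

end
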